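import Mathlib
import Literature.NumberTheory.Sieve.Maynard2016GPYWeights
import Literature.NumberTheory.Sieve.Maynard2016SingSeriesSplit
import Literature.NumberTheory.Sieve.Maynard2016SingSeriesPos
import Literature.NumberTheory.Sieve.Maynard2016BaseSetCount
import Literature.NumberTheory.Sieve.Maynard2016OmegaBound
import Literature.NumberTheory.Sieve.Maynard2016OmegaSmall
import Literature.NumberTheory.Sieve.Maynard2016Growth
import Literature.NumberTheory.Sieve.Maynard2016TupleArith
import HarnessLib

/-!
# Maynard 2016, Lemma 6 split: the counting step (6.1)–(6.7) and the main-term evaluation (6.8)–(6.20)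

Topic `Literature/NumberTheory/Sieve`. J. Maynard, *Large gaps between primes*, Ann. of Math. (2)
183 (2016), 915–933 = arXiv:1408.5110, §6, proof of Lemma 6 (pp. 9–11 of the arXiv text).

`Maynard2016.Lemma6` (`Maynard2016GPYWeights.lean`) is one of the two named facts left under
`Maynard2016_theorem1` (`Maynard2016Lemma7PerTuple.theorem1_of_lemma6_tuple`). Its printed proof has
two halves of a very different nature, and this file TYPES each half as a named fact and PROVES that
together they give `Lemma6`:

* **(6.1)–(6.7), the counting step** (`Lemma6Counting`). Expanding the square in
  `α_{m,q}⁻¹ = Σ_n (Σ_{d_i ∣ n+h_iq, e_i ∣ m(n+h_iq)−1} λ_{d,e})²` and swapping the summation, the inner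
  sum over `n < U/m`, `(n(mn−1), P_w) = 1` in the residue system cut out by `d, d', e, e'` is, by the
  Chinese remainder theorem, `U φ_ω(P_w)/(m P_w [d,d',e,e']) + O(φ_ω(P_w))` when the system is
  solvable and `0` otherwise ("there is no contribution unless `(d_i, e_j), (d'_i, e'_j) ∣ mq(h_j − h_i) − 1`,
  … `(d_i d'_i e_i e'_i, P_w) = 1`", p. 10), where `φ_ω(P_w) = #{n mod P_w : (n(mn−1),P_w)=1} =
  ∏_{p ≤ w}(p − ω_m(p))` (`classCount`, = `card_filter_range_Pw_coprime`). The solvability condition is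
  the predicate `Adm` below (the `[d_j,d'_j]` pairwise coprime, the `[e_j,e'_j]` pairwise coprime, all
  coprime to `P_w`, the `[e_j,e'_j]` coprime to `m` — implicit in the source, as `e_j ∣ m(n+h_jq) − 1` —
  and `([d_i,d'_i],[e_j,e'_j]) ∣ mq(h_j − h_i) − 1` for all `i, j`, which for `i = j` is coprimality),
  and the resulting main sum (6.7)/(6.8) is `mainSum = Σ'_{d,d',e,e'} λ_{d,e} λ_{d',e'}/[d,d',e,e']`.
  The error terms contribute `O(y^{2k} x^{1/5+o(1)})` ((6.7)); the typed form allows `x^{3/4}`.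
* **(6.8)–(6.20), the main term** (`Lemma6MainTerm`): the multiplicative sum is evaluated by "an
  argument … analogous to [Maynard 2015, Lemma 6.2 and 7.1] … based on Fourier analysis … a minor
  adaption of [Polymath 8b, Lemma 4.1]" (p. 10) — Fourier inversion for `e^t F(t)`, an Euler product whose
  factors at the primes `p ∣ ∏_{h,h'}(mq(h−h')−1)`, `w < p ≤ y` carry the extra factor
  `1 + #{(h,h') : p ∣ mq(h−h')−1}/p = 1 − (ω_{m,q}(p) − 2k)/p` up to `1 + O_k(p⁻² + log p √log x/(p log y))`
  ((6.12)–(6.14)), the simple pole of `ζ` ((6.15)–(6.18)) and the Fourier identity (6.19); the outcome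
  (6.20) is `mainSum = (1+o_k(1)) ∏_{p≤w}(1−1/p)^{−2k} ∏_{w<p≤y}(1−ω_{m,q}(p)/p)(1−1/p)^{−2k}
  I_k^{(1)}(F) I_k^{(2)}(G) (log x)^{−k} (log y)^{−k}` uniformly in `m, q` (the two products are
  `singSmall`, `singLarge`; `(1 − (ω−2k)/p) = (1 + O(k²p⁻²))(1 − ω/p)(1−1/p)^{−2k}` and
  `∏_{p>w}(1+O(k²p⁻²)) = 1 + o_k(1)` have been absorbed, as in the last line of the printed proof).
  The tree already holds the kernel-checked Polymath 8b Lemma 4.1 in exactly this Fourier form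
  (`PolymathLcmSumsProofs.tendsto_pow_mul_lcmSumW`, with `PolymathLcmSums{Colouring,Euler,Zeta,Fourier,Kernel}`),
  which is the engine a proof of `Lemma6MainTerm` adapts (two scales `log x`, `log y`; `W = P_w`; the
  coupled local factors at the primes dividing `∏(mq(h−h')−1)` and at the primes dividing `m`).
* **PROVED here**: the bookkeeping identity `𝔖_{m,q} = (φ_ω(P_w)/P_w) · singSmall · singLarge`
  (`singSeriesMQ_eq_classCount_mul`), a uniform lower bound `𝔖_{m,q} ≥ e^{−6π²k²}` for even `m` once
  `4k ≤ w` (`exp_neg_le_singSeriesMQ`; the source uses `𝔖_{m,q} > 0` and `o(1)`-uniformity tacitly), and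
  the assembly `Lemma6Counting → Lemma6MainTerm → Lemma6` (`lemma6_of_counting_mainTerm`): the
  counting error `x^{3/4}` is `o` of the main term `U 𝔖 I^{(1)} I^{(2)}/(m log^k x log^k y) ≫_k x log₂ x/(log x)^{2k}`.

No new analytic input is assumed; the two named facts are verbatim halves of the printed proof.
-/

open Filter Finset
open scoped BigOperators Topology

namespace Literature.NumberTheory.Sieve

namespace Maynard2016

/-! ### The objects of (6.7)–(6.8) -/

/-- The box `[1, X]^k` for the sieve variables `d = (d_1,…,d_k)` (any box containing the support of
`λ_{d,e}` — `∏ d_i ≤ x^{1/10}`, `e_i ≤ y` — gives the same sums; we use `X = x`). [cite: Maynard2016LargeGaps, §6 display (6.8)] -/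
def box (k X : ℕ) : Finset (Fin k → ℕ) := Fintype.piFinset fun _ : Fin k => Finset.Icc 1 X

/-- **Solvability of the residue system** cut out by `(d, d', e, e')` (§6, p. 10, the conditions of `Σ'`
in (6.8) together with "there is no contribution unless …"): writing `D_i = [d_i, d'_i]`, `E_i = [e_i, e'_i]`,
the `D_i` are pairwise coprime, the `E_i` are pairwise coprime, all are coprime to `P_w`, the `E_i` are
coprime to `m` (implicit in the source: `e_i ∣ m(n + h_i q) − 1`), and `(D_i, E_j) ∣ mq(h_j − h_i) − 1`
for all `i, j` (divisibility in `ℤ`; for `i = j` this reads `(D_i, E_i) = 1`). [cite: Maynard2016LargeGaps, §6 display (6.8)] -/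
def Adm (k x m q : ℕ) (d d' e e' : Fin k → ℕ) : Prop :=
  (∀ i j : Fin k, i ≠ j → Nat.Coprime (Nat.lcm (d i) (d' i)) (Nat.lcm (d j) (d' j))) ∧
  (∀ i j : Fin k, i ≠ j → Nat.Coprime (Nat.lcm (e i) (e' i)) (Nat.lcm (e j) (e' j))) ∧
  (∀ i : Fin k, Nat.Coprime (Nat.lcm (d i) (d' i)) (Pw x)) ∧
  (∀ i : Fin k, Nat.Coprime (Nat.lcm (e i) (e' i)) (Pw x)) ∧
  (∀ i : Fin k, Nat.Coprime (Nat.lcm (e i) (e' i)) m) ∧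
  (∀ i j : Fin k, ((Nat.gcd (Nat.lcm (d i) (d' i)) (Nat.lcm (e j) (e' j)) : ℕ) : ℤ) ∣
      (m : ℤ) * q * ((hTuple k x j : ℤ) - hTuple k x i) - 1)

/-- `φ_ω(P_w) = #{n mod P_w : (n(mn − 1), P_w) = 1} = ∏_{p ≤ w} (p − ω_m(p))`, `ω_m(p) = 1` if `p ∣ m`
and `2` otherwise (the number of admissible classes modulo `P_w`, cf. `card_filter_range_Pw_coprime`).
[cite: Maynard2016LargeGaps, §6 displays (6.6), (6.17)] -/
noncomputable def classCount (x m : ℕ) : ℝ :=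
  ∏ p ∈ (Finset.range (⌊wFun x⌋₊ + 1)).filter Nat.Prime, ((p : ℝ) - ((if p ∣ m then 1 else 2 : ℕ) : ℝ))

open scoped Classical in
/-- **The main multiplicative sum (6.7)/(6.8)**:
`Σ'_{d,d',e,e'} λ_{d,e} λ_{d',e'} / [d, d', e, e']`, the variables in `[1, x]`, the dash denoting the
solvability conditions `Adm`, and `[d,d',e,e'] = lcm(∏_i [d_i,d'_i], ∏_i [e_i,e'_i])`. [cite: Maynard2016LargeGaps, §6 displays (6.7)–(6.8)] -/
noncomputable def mainSum {k J : ℕ} (c : Fin J → ℝ) (Fd : Fin k → Fin J → ℝ → ℝ) (G : ℝ → ℝ)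
    (ε : ℝ) (x m q : ℕ) : ℝ :=
  ∑ d ∈ box k x, ∑ d' ∈ box k x, ∑ e ∈ box k x, ∑ e' ∈ box k x,
    if Adm k x m q d d' e e' then
      lam c Fd G ε x d e * lam c Fd G ε x d' e' /
        (Nat.lcm (∏ i, Nat.lcm (d i) (d' i)) (∏ i, Nat.lcm (e i) (e' i)) : ℝ)
    else 0

/-- `∏_{p ≤ w} (1 − 1/p)^{−2k}` (the `P_w`-part of (6.16)/(6.20)). [cite: Maynard2016LargeGaps, §6 display (6.20)] -/
noncomputable def singSmall (k x : ℕ) : ℝ :=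
  ∏ p ∈ (Finset.Iic ⌊wFun x⌋₊).filter Nat.Prime, ((1 - 1 / (p : ℝ)) ^ (2 * k))⁻¹

/-- `∏_{w < p ≤ y} (1 − ω_{m,q}(p)/p)(1 − 1/p)^{−2k}` (the `q`-dependent part of `𝔖_{m,q}`, (6.20)).
[cite: Maynard2016LargeGaps, §6 display (6.20)] -/
noncomputable def singLarge (k : ℕ) (ε : ℝ) (x m q : ℕ) : ℝ :=
  ∏ p ∈ (Finset.Ioc ⌊wFun x⌋₊ ⌊y ε x⌋₊).filter Nat.Prime,
    (1 - (omegaMQ k x m q p : ℝ) / p) * ((1 - 1 / (p : ℝ)) ^ (2 * k))⁻¹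

/-! ### The two halves of the proof of Lemma 6 as named facts -/

/-- **Maynard 2016, proof of Lemma 6, displays (6.1)–(6.7) (the counting step).** For `C_U > 0`,
all small `ε > 0`, `k ≥ 1` and smooth data: for all large `x`, every even `m < U z⁻¹(log₂ x)⁻²` and every
prime `q ∈ [x/2, x]`,
`|α_{m,q}⁻¹ − (U/m)(φ_ω(P_w)/P_w) Σ'_{d,d',e,e'} λ_{d,e}λ_{d',e'}/[d,d',e,e']| ≤ x^{3/4}`
(the source's error is `O(y^{2k} x^{1/5+o(1)})`, from `|λ| ≪ 1`, `∏ d_i ≤ x^{1/10}`, `e_i ≤ y` and the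
`O(φ_ω(P_w))` boundary terms of the Chinese remainder theorem). Named fact, not proved here.
[cite: Maynard2016LargeGaps, §6 displays (6.1)–(6.7)] -/
def Lemma6Counting : Prop :=
  ∀ C_U : ℝ, 0 < C_U → ∀ᶠ ε : ℝ in 𝓝[>] 0, ∀ k : ℕ, 1 ≤ k →
    ∀ (J : ℕ) (c : Fin J → ℝ) (Fd : Fin k → Fin J → ℝ → ℝ) (G : ℝ → ℝ), IsSieveData k J c Fd G →
      ∀ᶠ x : ℕ in atTop,
        ∀ m : ℕ, 1 ≤ m → Even m → (m : ℝ) < U C_U ε x / (z x * (Real.log (Real.log x)) ^ 2) →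
          ∀ q : ℕ, q.Prime → (x : ℝ) / 2 ≤ q → (q : ℝ) ≤ x →
            |normInv c Fd G C_U ε x m q -
                U C_U ε x / m * (classCount x m / Pw x) * mainSum c Fd G ε x m q| ≤
              (x : ℝ) ^ (3 / 4 : ℝ)

/-- **Maynard 2016, proof of Lemma 6, displays (6.8)–(6.20) (evaluation of the main term).** For
`C_U > 0`, all small `ε > 0`, `k ≥ 1`, smooth data with `I^{(1)}, I^{(2)} > 0` and `κ > 0`: for all large `x`,
every even `m < U z⁻¹(log₂ x)⁻²` and every prime `q ∈ [x/2, x]`,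
`|Σ' λλ'/[d,d',e,e'] · (log x)^k (log y)^k − ∏_{p≤w}(1−1/p)^{−2k} ∏_{w<p≤y}(1−ω_{m,q}(p)/p)(1−1/p)^{−2k} I^{(1)} I^{(2)}|
≤ κ · (the same product)` — display (6.20) with `Σ_{j,j'} c_j c_{j'} ∏_ℓ ∫ F'_{ℓ,j}F'_{ℓ,j'} = I^{(1)}(F)`,
`(∫ G'²)^k = I^{(2)}(G)`, uniformly in `m, q` ("a minor adaption of the argument of [Polymath 8b, Lemma 4.1]").
Named fact, not proved here. [cite: Maynard2016LargeGaps, §6 displays (6.8)–(6.20)] [cite: Polymath8b2014, Lemma 4.1] -/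
def Lemma6MainTerm : Prop :=
  ∀ C_U : ℝ, 0 < C_U → ∀ᶠ ε : ℝ in 𝓝[>] 0, ∀ k : ℕ, 1 ≤ k →
    ∀ (J : ℕ) (c : Fin J → ℝ) (Fd : Fin k → Fin J → ℝ → ℝ) (G : ℝ → ℝ),
      IsSieveData k J c Fd G → 0 < I1 c Fd → 0 < I2 k G → ∀ κ : ℝ, 0 < κ →
        ∀ᶠ x : ℕ in atTop,
          ∀ m : ℕ, 1 ≤ m → Even m → (m : ℝ) < U C_U ε x / (z x * (Real.log (Real.log x)) ^ 2) →
            ∀ q : ℕ, q.Prime → (x : ℝ) / 2 ≤ q → (q : ℝ) ≤ x →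
              |mainSum c Fd G ε x m q * (Real.log x) ^ k * (Real.log (y ε x)) ^ k -
                  singSmall k x * singLarge k ε x m q * I1 c Fd * I2 k G| ≤
                κ * (singSmall k x * singLarge k ε x m q * I1 c Fd * I2 k G)

/-! ### Bookkeeping: `𝔖_{m,q} = (φ_ω(P_w)/P_w) · singSmall · singLarge` -/

/-- For `k ≥ 1` and `⌊w⌋ ≤ ⌊y⌋`:
`𝔖_{m,q} = (∏_{p≤w}(p − ω_m(p))/P_w) · ∏_{p≤w}(1−1/p)^{−2k} · ∏_{w<p≤y}(1−ω_{m,q}(p)/p)(1−1/p)^{−2k}`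
((5.2) split at `w`, with `ω_{m,q}(p) = ω_m(p)` for `p ≤ w`, display (6.6), and
`φ_ω(P_w)/P_w = ∏_{p≤w}(1 − ω_m(p)/p)`, display (6.17)). [cite: Maynard2016LargeGaps, §6 displays (6.17), (6.20)] -/
theorem singSeriesMQ_eq_classCount_mul {k : ℕ} (hk : 0 < k) (ε : ℝ) (x m q : ℕ)
    (hwy : ⌊wFun x⌋₊ ≤ ⌊y ε x⌋₊) :
    singSeriesMQ k ε x m q = classCount x m / Pw x * singSmall k x * singLarge k ε x m q := by
  rw [singSeriesMQ_split k ε x m q hwy, prod_small_eq hk x m q, Finset.prod_mul_distrib,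
    classCount, prod_sub_div_Pw_eq m x]
  rfl

/-- `φ_ω(P_w) ≥ 0`. [cite: Maynard2016LargeGaps, §6 display (6.6)] -/
theorem classCount_nonneg (x m : ℕ) : 0 ≤ classCount x m := prod_sub_nonneg m x

/-! ### A uniform lower bound for the singular series -/

/-- `e^{−2t} ≤ 1 − t` for `0 ≤ t ≤ 1/2`. [folklore] -/
private theorem exp_neg_two_mul_le {t : ℝ} (ht0 : 0 ≤ t) (ht : t ≤ 1 / 2) : Real.exp (-(2 * t)) ≤ 1 - t := by
  have h1 : 2 * t + 1 ≤ Real.exp (2 * t) := Real.add_one_le_exp _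
  have h2 : 0 < 2 * t + 1 := by linarith
  rw [Real.exp_neg]
  calc (Real.exp (2 * t))⁻¹ ≤ (2 * t + 1)⁻¹ := inv_anti₀ h2 h1
    _ ≤ 1 - t := by
        rw [inv_le_iff_one_le_mul₀ h2]
        nlinarith

/-- **Local lower bound.** For `k ≥ 1`, `m` even, a prime `p` and `4k ≤ ⌊w⌋`:
`(1 − ω_{m,q}(p)/p)(1 − 1/p)^{−2k} ≥ exp(−32k²/p²)` — for `p ≤ w` because `ω = ω_m(p) ∈ {1,2}`
(`ω(2) = 1` as `m` is even), for `p > w ≥ 4k` because `ω ≤ 2k` and `(1−2k/p)(1+2k/p) = 1 − 4k²/p²`.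
[cite: Maynard2016LargeGaps, §5 displays (5.1)–(5.2)] -/
theorem exp_neg_le_local_factor {k : ℕ} (hk : 0 < k) {x m : ℕ} (q : ℕ) (hm : Even m) {p : ℕ}
    (hp : p.Prime) (hw : 4 * k ≤ ⌊wFun x⌋₊) :
    Real.exp (-(32 * (k : ℝ) ^ 2 / (p : ℝ) ^ 2)) ≤
      (1 - (omegaMQ k x m q p : ℝ) / p) * ((1 - 1 / (p : ℝ)) ^ (2 * k))⁻¹ := by
  have hk1 : (1 : ℝ) ≤ k := by exact_mod_cast hk
  have hp2 : (2 : ℝ) ≤ p := by exact_mod_cast hp.two_le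
  have hp0 : (0 : ℝ) < p := by linarith
  have hsub0 : 0 < 1 - 1 / (p : ℝ) := by
    rw [sub_pos, div_lt_one hp0]; linarith
  have hsub1 : 1 - 1 / (p : ℝ) ≤ 1 := by
    have : 0 ≤ 1 / (p : ℝ) := by positivity
    linarith
  have hpowpos : 0 < (1 - 1 / (p : ℝ)) ^ (2 * k) := pow_pos hsub0 _
  by_cases hpw : p ∣ Pw x
  · -- `p ≤ w`: `ω = ω_m(p)`
    rw [omegaMQ_eq_of_dvd_Pw hk x m q hp hpw]
    rcases hp.eq_two_or_odd' with rfl | hodd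
    · -- `p = 2`, `m` even: the factor is `2^{2k}/2 ≥ 1`
      rw [if_pos (even_iff_two_dvd.1 hm)]
      have hge1 : (1 : ℝ) ≤ (1 - ((1 : ℕ) : ℝ) / (2 : ℕ)) * ((1 - 1 / ((2 : ℕ) : ℝ)) ^ (2 * k))⁻¹ := by
        push_cast
        have h12 : (1 : ℝ) - 1 / 2 = 2⁻¹ := by norm_num
        rw [h12, inv_pow, inv_inv]
        have h4 : (4 : ℝ) ≤ 2 ^ (2 * k) := by
          calc (4 : ℝ) = 2 ^ (2 * 1) := by norm_num
            _ ≤ 2 ^ (2 * k) := pow_le_pow_right₀ (by norm_num) (by omega)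
        rw [inv_mul_eq_div, le_div_iff₀ (by norm_num : (0 : ℝ) < 2)]
        linarith
      refine le_trans ?_ hge1
      rw [Real.exp_le_one_iff, neg_nonpos]
      positivity
    · -- odd prime `p ≥ 3`: `ω ≤ 2`, factor `≥ (1 − 2/p)(1 − 1/p)^{−2} = 1 − 1/(p−1)² ≥ e^{−2/(p−1)²}`
      have h3 : (3 : ℝ) ≤ p := by
        have : 3 ≤ p := by
          rcases hodd with ⟨t, ht⟩
          have := hp.two_le
          omega
        exact_mod_cast this
      have hω2 : ((if p ∣ m then 1 else 2 : ℕ) : ℝ) ≤ 2 := by split_ifs <;> norm_num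
      -- first factor ≥ 1 − 2/p > 0
      have hA : 1 - 2 / (p : ℝ) ≤ 1 - ((if p ∣ m then 1 else 2 : ℕ) : ℝ) / p := by
        have := div_le_div_of_nonneg_right hω2 hp0.le
        linarith
      have hA0 : 0 < 1 - 2 / (p : ℝ) := by
        rw [sub_pos, div_lt_one hp0]; linarith
      -- second factor ≥ (1 − 1/p)^{−2}
      have hB : ((1 - 1 / (p : ℝ)) ^ 2)⁻¹ ≤ ((1 - 1 / (p : ℝ)) ^ (2 * k))⁻¹ := by
        apply inv_anti₀ hpowpos
        exact pow_le_pow_of_le_one hsub0.le hsub1 (by omega)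
      have hB0 : 0 < ((1 - 1 / (p : ℝ)) ^ 2)⁻¹ := by positivity
      -- the product `(1 − 2/p)(1 − 1/p)^{−2} = 1 − 1/(p−1)²`
      have hprod : (1 - 2 / (p : ℝ)) * ((1 - 1 / (p : ℝ)) ^ 2)⁻¹ = 1 - 1 / ((p : ℝ) - 1) ^ 2 := by
        have hp1 : (p : ℝ) - 1 ≠ 0 := by linarith
        field_simp
        ring
      -- `e^{−32k²/p²} ≤ e^{−2/(p−1)²} ≤ 1 − 1/(p−1)²`
      have hp1pos : 0 < (p : ℝ) - 1 := by linarith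
      have hp1sq : 0 < ((p : ℝ) - 1) ^ 2 := pow_pos hp1pos 2
      have ht0 : 0 ≤ 1 / ((p : ℝ) - 1) ^ 2 := div_nonneg zero_le_one hp1sq.le
      have ht : 1 / ((p : ℝ) - 1) ^ 2 ≤ 1 / 2 := by
        rw [div_le_div_iff₀ hp1sq (by norm_num)]
        nlinarith
      have hexp : Real.exp (-(32 * (k : ℝ) ^ 2 / (p : ℝ) ^ 2)) ≤
          Real.exp (-(2 * (1 / ((p : ℝ) - 1) ^ 2))) := by
        rw [Real.exp_le_exp, neg_le_neg_iff]
        -- `2/(p−1)² ≤ 32k²/p²` since `p² ≤ 16 k² (p−1)²` (`p/(p−1) ≤ 3/2 ≤ 4k`)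
        rw [mul_one_div, div_le_div_iff₀ hp1sq (by positivity)]
        have h1 : (p : ℝ) ≤ 2 * ((p : ℝ) - 1) := by linarith
        have h2 : (p : ℝ) ^ 2 ≤ 4 * ((p : ℝ) - 1) ^ 2 := by nlinarith
        have h3' : 4 * ((p : ℝ) - 1) ^ 2 ≤ 16 * (k : ℝ) ^ 2 * ((p : ℝ) - 1) ^ 2 := by
          have : (1 : ℝ) ≤ (k : ℝ) ^ 2 := by nlinarith
          nlinarith [sq_nonneg ((p : ℝ) - 1)]
        nlinarith
      calc Real.exp (-(32 * (k : ℝ) ^ 2 / (p : ℝ) ^ 2))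
          ≤ Real.exp (-(2 * (1 / ((p : ℝ) - 1) ^ 2))) := hexp
        _ ≤ 1 - 1 / ((p : ℝ) - 1) ^ 2 := exp_neg_two_mul_le ht0 ht
        _ = (1 - 2 / (p : ℝ)) * ((1 - 1 / (p : ℝ)) ^ 2)⁻¹ := hprod.symm
        _ ≤ (1 - ((if p ∣ m then 1 else 2 : ℕ) : ℝ) / p) * ((1 - 1 / (p : ℝ)) ^ (2 * k))⁻¹ :=
            mul_le_mul hA hB hB0.le (hA0.le.trans hA)
  · -- `p > w ≥ 4k`: `ω ≤ 2k`
    have hwp : ⌊wFun x⌋₊ < p := by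
      by_contra h
      exact hpw (by unfold Pw; exact hp.dvd_primorial_iff.2 (not_lt.1 h))
    have hkp : 4 * (k : ℝ) + 1 ≤ p := by
      have : 4 * k + 1 ≤ p := by omega
      exact_mod_cast this
    have hω : (omegaMQ k x m q p : ℝ) ≤ 2 * k := by exact_mod_cast omegaMQ_le_two_mul k x m q hp
    -- first factor ≥ 1 − 2k/p > 0
    have hA : 1 - 2 * (k : ℝ) / p ≤ 1 - (omegaMQ k x m q p : ℝ) / p := by
      have := div_le_div_of_nonneg_right hω hp0.le
      linarith
    have hA0 : 0 < 1 - 2 * (k : ℝ) / p := by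
      rw [sub_pos, div_lt_one hp0]; linarith
    -- second factor ≥ 1 + 2k/p (Bernoulli)
    have hB : 1 + 2 * (k : ℝ) / p ≤ ((1 - 1 / (p : ℝ)) ^ (2 * k))⁻¹ := by
      rw [← inv_pow]
      have hinv : 1 + 1 / (p : ℝ) ≤ (1 - 1 / (p : ℝ))⁻¹ := by
        rw [le_inv_comm₀ (by positivity) hsub0]
        have h1 : (1 + 1 / (p : ℝ)) * (1 - 1 / (p : ℝ)) = 1 - 1 / (p : ℝ) ^ 2 := by ring
        have h2 : (1 + 1 / (p : ℝ))⁻¹ * (1 + 1 / (p : ℝ)) = 1 :=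
          inv_mul_cancel₀ (by positivity)
        have h3 : 0 < (1 + 1 / (p : ℝ))⁻¹ := by positivity
        nlinarith [sq_nonneg (1 / (p : ℝ)), h1, h2, h3,
          show 0 ≤ 1 / (p : ℝ) ^ 2 by positivity,
          mul_le_mul_of_nonneg_left (show 1 - 1 / (p : ℝ) ^ 2 ≤ 1 by
            have : 0 ≤ 1 / (p : ℝ) ^ 2 := by positivity
            linarith) h3.le]
      have hbern : 1 + (2 * k : ℕ) * (1 / (p : ℝ)) ≤ (1 + 1 / (p : ℝ)) ^ (2 * k) :=
        one_add_mul_le_pow (by linarith [show (0 : ℝ) ≤ 1 / (p : ℝ) from by positivity]) _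
      calc 1 + 2 * (k : ℝ) / p = 1 + (2 * k : ℕ) * (1 / (p : ℝ)) := by push_cast; ring
        _ ≤ (1 + 1 / (p : ℝ)) ^ (2 * k) := hbern
        _ ≤ ((1 - 1 / (p : ℝ))⁻¹) ^ (2 * k) :=
            pow_le_pow_left₀ (by positivity) hinv _
    have hB0 : 0 < 1 + 2 * (k : ℝ) / p := by positivity
    -- `(1 − 2k/p)(1 + 2k/p) = 1 − 4k²/p² ≥ e^{−8k²/p²} ≥ e^{−32k²/p²}`
    have ht0 : 0 ≤ 4 * (k : ℝ) ^ 2 / (p : ℝ) ^ 2 := by positivity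
    have ht : 4 * (k : ℝ) ^ 2 / (p : ℝ) ^ 2 ≤ 1 / 2 := by
      rw [div_le_div_iff₀ (by positivity) (by norm_num)]
      nlinarith
    have hexp : Real.exp (-(32 * (k : ℝ) ^ 2 / (p : ℝ) ^ 2)) ≤
        Real.exp (-(2 * (4 * (k : ℝ) ^ 2 / (p : ℝ) ^ 2))) := by
      rw [Real.exp_le_exp, neg_le_neg_iff, ← mul_div_assoc, div_le_div_iff_of_pos_right (by positivity)]
      nlinarith
    calc Real.exp (-(32 * (k : ℝ) ^ 2 / (p : ℝ) ^ 2))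
        ≤ Real.exp (-(2 * (4 * (k : ℝ) ^ 2 / (p : ℝ) ^ 2))) := hexp
      _ ≤ 1 - 4 * (k : ℝ) ^ 2 / (p : ℝ) ^ 2 := exp_neg_two_mul_le ht0 ht
      _ = (1 - 2 * (k : ℝ) / p) * (1 + 2 * (k : ℝ) / p) := by
          field_simp
          ring
      _ ≤ (1 - (omegaMQ k x m q p : ℝ) / p) * ((1 - 1 / (p : ℝ)) ^ (2 * k))⁻¹ :=
          mul_le_mul hA hB hB0.le (hA0.le.trans hA)

/-- **Uniform lower bound for the singular series**: for `k ≥ 1`, `m` even, every `q`, every `ε` and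
`4k ≤ ⌊w⌋`: `𝔖_{m,q} ≥ exp(−32k² · π²/6)` (product of the local bounds and `Σ_p p⁻² ≤ ζ(2)`).
[cite: Maynard2016LargeGaps, §5 display (5.2)] -/
theorem exp_neg_le_singSeriesMQ {k : ℕ} (hk : 0 < k) (ε : ℝ) {x m : ℕ} (q : ℕ) (hm : Even m)
    (hw : 4 * k ≤ ⌊wFun x⌋₊) :
    Real.exp (-(32 * (k : ℝ) ^ 2 * (Real.pi ^ 2 / 6))) ≤ singSeriesMQ k ε x m q := by
  set S := (Finset.Iic ⌊y ε x⌋₊).filter Nat.Prime with hS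
  have hsum : ∑ p ∈ S, 1 / (p : ℝ) ^ 2 ≤ Real.pi ^ 2 / 6 :=
    sum_le_hasSum S (fun n _ => by positivity) hasSum_zeta_two
  calc Real.exp (-(32 * (k : ℝ) ^ 2 * (Real.pi ^ 2 / 6)))
      ≤ Real.exp (∑ p ∈ S, -(32 * (k : ℝ) ^ 2 / (p : ℝ) ^ 2)) := by
        rw [Real.exp_le_exp]
        have : ∑ p ∈ S, -(32 * (k : ℝ) ^ 2 / (p : ℝ) ^ 2) =
            -(32 * (k : ℝ) ^ 2 * ∑ p ∈ S, 1 / (p : ℝ) ^ 2) := by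
          rw [Finset.mul_sum, ← Finset.sum_neg_distrib]
          refine Finset.sum_congr rfl fun p _ => ?_
          ring
        rw [this, neg_le_neg_iff]
        exact mul_le_mul_of_nonneg_left hsum (by positivity)
    _ = ∏ p ∈ S, Real.exp (-(32 * (k : ℝ) ^ 2 / (p : ℝ) ^ 2)) := Real.exp_sum _ _
    _ ≤ singSeriesMQ k ε x m q := by
        unfold singSeriesMQ
        refine Finset.prod_le_prod (fun p _ => (Real.exp_pos _).le) fun p hp => ?_
        exact exp_neg_le_local_factor hk q hm (Finset.mem_filter.1 hp).2 hw

/-- **Eventually `𝔖_{m,q} ≥ exp(−32k²π²/6)`** for every even `m` and every `q` (`k ≥ 1`, any `ε`).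
[cite: Maynard2016LargeGaps, §5 display (5.2)] -/
theorem eventually_exp_neg_le_singSeriesMQ {k : ℕ} (hk : 0 < k) (ε : ℝ) :
    ∀ᶠ x : ℕ in atTop, ∀ m : ℕ, Even m → ∀ q : ℕ,
      Real.exp (-(32 * (k : ℝ) ^ 2 * (Real.pi ^ 2 / 6))) ≤ singSeriesMQ k ε x m q := by
  filter_upwards [eventually_le_wFun ((4 * k : ℕ) : ℝ)] with x hx m hm q
  exact exp_neg_le_singSeriesMQ hk ε q hm (Nat.le_floor hx)

/-! ### The counting error is negligible against the main term -/

/-- `log y ≤ log x` once `0 ≤ ε ≤ 1`, `0 ≤ log x`, `0 < log₂ x` and `log₃ x ≤ log₂ x`. [cite: Maynard2016LargeGaps, §2 display (2.1)] -/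
theorem log_y_le_log {ε : ℝ} (hε0 : 0 ≤ ε) (hε1 : ε ≤ 1) {x : ℕ} (hL : 0 ≤ Real.log x)
    (hL₂ : 0 < Real.log (Real.log x))
    (hL₃₂ : Real.log (Real.log (Real.log x)) ≤ Real.log (Real.log x)) :
    Real.log (y ε x) ≤ Real.log x := by
  rw [log_y]
  have h1 : Real.log (Real.log (Real.log (x : ℝ))) / Real.log (Real.log x) ≤ 1 := by
    rwa [div_le_one hL₂]
  have h3 : (1 - ε) * (Real.log x * Real.log (Real.log (Real.log (x : ℝ))) /
      Real.log (Real.log x)) = (1 - ε) * Real.log x *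
        (Real.log (Real.log (Real.log (x : ℝ))) / Real.log (Real.log x)) := by ring
  rw [h3]
  have h4 : 0 ≤ (1 - ε) * Real.log x := mul_nonneg (by linarith) hL
  calc (1 - ε) * Real.log x * (Real.log (Real.log (Real.log (x : ℝ))) / Real.log (Real.log x))
      ≤ (1 - ε) * Real.log x * 1 := mul_le_mul_of_nonneg_left h1 h4
    _ ≤ Real.log x := by nlinarith

/-- **The main term dominates `x^{3/4}`:** for `k ≥ 1`, `0 < ε ≤ 1/2`, `I^{(1)}, I^{(2)} > 0`
and `κ > 0`, for all large `x`, every even `m ≥ 1` with `m < U z⁻¹ (log₂ x)⁻²` and every `q`: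
`x^{3/4} ≤ κ · U 𝔖_{m,q} I^{(1)} I^{(2)} / (m (log x)^k (log y)^k)` (as `U/m > z (log₂ x)² = x log₂ x`,
`𝔖_{m,q} ≫_k 1`, `log y ≤ log x` and `(log x)^{2k} = o(x^{1/4})`). [cite: Maynard2016LargeGaps, §6 display (6.7)] -/
theorem eventually_rpow_le_mul_main {k J : ℕ} (hk : 0 < k) {c : Fin J → ℝ}
    {Fd : Fin k → Fin J → ℝ → ℝ} {G : ℝ → ℝ} {C_U ε : ℝ} (hε0 : 0 < ε)
    (hε : ε ≤ 1 / 2) (hI1 : 0 < I1 c Fd) (hI2 : 0 < I2 k G) {κ : ℝ} (hκ : 0 < κ) :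
    ∀ᶠ x : ℕ in atTop, ∀ m : ℕ, 1 ≤ m → Even m →
      (m : ℝ) < U C_U ε x / (z x * (Real.log (Real.log x)) ^ 2) → ∀ q : ℕ,
        (x : ℝ) ^ (3 / 4 : ℝ) ≤
          κ * (U C_U ε x * singSeriesMQ k ε x m q * I1 c Fd * I2 k G /
            (m * (Real.log x) ^ k * (Real.log (y ε x)) ^ k)) := by
  set c₀ : ℝ := Real.exp (-(32 * (k : ℝ) ^ 2 * (Real.pi ^ 2 / 6))) with hc₀
  have hc₀pos : 0 < c₀ := Real.exp_pos _
  set A : ℝ := κ * (c₀ * I1 c Fd * I2 k G) with hA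
  have hApos : 0 < A := by positivity
  -- `(log X)^{2k} ≤ A X^{1/4}` for large real `X`
  have hreal : ∀ᶠ X : ℝ in atTop, Real.log X ^ (2 * k) ≤ A * X ^ (1 / 4 : ℝ) := by
    have hlo := (isLittleO_log_rpow_rpow_atTop ((2 * k : ℕ) : ℝ) (by norm_num : (0 : ℝ) < 1 / 4)).def hApos
    filter_upwards [hlo, eventually_ge_atTop (1 : ℝ)] with X hX hX1
    rw [Real.norm_eq_abs, Real.norm_eq_abs, Real.rpow_natCast, abs_of_nonneg (pow_nonneg (Real.log_nonneg hX1) _),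
      abs_of_nonneg (Real.rpow_nonneg (by linarith) _)] at hX
    exact hX
  filter_upwards [tendsto_natCast_atTop_atTop.eventually hreal, eventually_iteratedLogs,
    eventually_wTrick hε, eventually_exp_neg_le_singSeriesMQ hk ε, eventually_ge_atTop 1]
    with x hx hlogs hw hS hx1 m hm hmev hmU q
  obtain ⟨hL4, hL₂2, hL₃1, hL₃₂, -, -, -⟩ := hlogs
  obtain ⟨-, hly, -⟩ := hw
  have hx0 : (0 : ℝ) < x := by exact_mod_cast hx1
  have hL0 : 0 < Real.log x := by linarith
  have hL₂0 : 0 < Real.log (Real.log x) := by linarith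
  have hm0 : (0 : ℝ) < m := by exact_mod_cast hm
  have hSx := hS m hmev q
  have hSpos : 0 < singSeriesMQ k ε x m q := hc₀pos.trans_le hSx
  -- `U/m > z (log₂ x)² = x log₂ x ≥ x`, so `U ≥ m x`
  have hzL : z x * (Real.log (Real.log x)) ^ 2 = (x : ℝ) * Real.log (Real.log x) := by
    unfold z; field_simp
  have hzpos : 0 < z x * (Real.log (Real.log x)) ^ 2 := by rw [hzL]; positivity
  have hUm : (m : ℝ) * x ≤ U C_U ε x := by
    have h1 := (lt_div_iff₀ hzpos).1 hmU
    rw [hzL] at h1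
    have h2 : (m : ℝ) * x ≤ m * (x * Real.log (Real.log x)) :=
      mul_le_mul_of_nonneg_left (le_mul_of_one_le_right hx0.le (by linarith)) hm0.le
    linarith
  have hUpos : 0 < U C_U ε x := lt_of_lt_of_le (by positivity) hUm
  -- `log y ≤ log x`
  have hlyL : Real.log (y ε x) ≤ Real.log x :=
    log_y_le_log hε0.le (by linarith) hL0.le hL₂0 (by linarith)
  have hden_le : (m : ℝ) * Real.log x ^ k * Real.log (y ε x) ^ k ≤ m * Real.log x ^ (2 * k) := by
    rw [two_mul, pow_add, mul_assoc]
    exact mul_le_mul_of_nonneg_left (mul_le_mul_of_nonneg_left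
      (pow_le_pow_left₀ hly.le hlyL k) (pow_nonneg hL0.le _)) hm0.le
  have hden_pos : 0 < (m : ℝ) * Real.log x ^ k * Real.log (y ε x) ^ k := by positivity
  -- the main term is `≥ c₀ I1 I2 x/(log x)^{2k}`
  have hmain : c₀ * I1 c Fd * I2 k G * x / Real.log x ^ (2 * k) ≤
      U C_U ε x * singSeriesMQ k ε x m q * I1 c Fd * I2 k G /
        (m * (Real.log x) ^ k * (Real.log (y ε x)) ^ k) := by
    rw [div_le_div_iff₀ (by positivity) hden_pos]
    have hnum : c₀ * I1 c Fd * I2 k G * x * (m : ℝ) ≤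
        U C_U ε x * singSeriesMQ k ε x m q * I1 c Fd * I2 k G := by
      have h1 : c₀ * ((m : ℝ) * x) ≤ singSeriesMQ k ε x m q * U C_U ε x :=
        mul_le_mul hSx hUm (by positivity) (singSeriesMQ_nonneg k ε x m q)
      have hI : 0 < I1 c Fd * I2 k G := mul_pos hI1 hI2
      nlinarith
    calc c₀ * I1 c Fd * I2 k G * ↑x * (↑m * Real.log ↑x ^ k * Real.log (y ε x) ^ k)
        ≤ c₀ * I1 c Fd * I2 k G * ↑x * (↑m * Real.log ↑x ^ (2 * k)) :=
          mul_le_mul_of_nonneg_left hden_le (by positivity)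
      _ = (c₀ * I1 c Fd * I2 k G * ↑x * ↑m) * Real.log ↑x ^ (2 * k) := by ring
      _ ≤ (U C_U ε x * singSeriesMQ k ε x m q * I1 c Fd * I2 k G) * Real.log ↑x ^ (2 * k) :=
          mul_le_mul_of_nonneg_right hnum (by positivity)
  -- and `x^{3/4} ≤ κ c₀ I1 I2 x/(log x)^{2k}` by the choice of `x`
  have hx34 : (x : ℝ) ^ (3 / 4 : ℝ) ≤ κ * (c₀ * I1 c Fd * I2 k G * x / Real.log x ^ (2 * k)) := by
    have hLk : 0 < Real.log x ^ (2 * k) := by positivity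
    rw [mul_div_assoc', le_div_iff₀ hLk]
    calc (x : ℝ) ^ (3 / 4 : ℝ) * Real.log x ^ (2 * k)
        ≤ (x : ℝ) ^ (3 / 4 : ℝ) * (A * (x : ℝ) ^ (1 / 4 : ℝ)) :=
          mul_le_mul_of_nonneg_left hx (by positivity)
      _ = A * ((x : ℝ) ^ (3 / 4 : ℝ) * (x : ℝ) ^ (1 / 4 : ℝ)) := by ring
      _ = A * x := by rw [← Real.rpow_add hx0]; norm_num
      _ = κ * (c₀ * I1 c Fd * I2 k G * x) := by rw [hA]; ring
  exact hx34.trans (mul_le_mul_of_nonneg_left hmain hκ.le)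

/-! ### Assembly: the two halves give Lemma 6 -/

/-- `(0, 1/2] ∈ 𝓝[>] 0`: eventually along `ε → 0⁺` we have `0 < ε ≤ 1/2`. [folklore] -/
private theorem eventually_pos_le_half : ∀ᶠ ε : ℝ in 𝓝[>] 0, 0 < ε ∧ ε ≤ 1 / 2 := by
  filter_upwards [Ioo_mem_nhdsGT (show (0 : ℝ) < 1 / 2 by norm_num)] with ε hε
  exact ⟨hε.1, hε.2.le⟩

/-- **Maynard 2016, Lemma 6 from its two halves**: the counting step (6.1)–(6.7) and the main-term
evaluation (6.8)–(6.20) imply Lemma 6, through `𝔖_{m,q} = (φ_ω(P_w)/P_w)·∏_{p≤w}(1−1/p)^{−2k}·∏_{w<p≤y}(…)`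
and `x^{3/4} = o(U𝔖 I^{(1)}I^{(2)}/(m log^k x log^k y))`. [cite: Maynard2016LargeGaps, Lemma 6] -/
theorem lemma6_of_counting_mainTerm (hA : Lemma6Counting) (hB : Lemma6MainTerm) : Lemma6 := by
  intro C_U hCU
  filter_upwards [hA C_U hCU, hB C_U hCU, eventually_pos_le_half] with ε hAε hBε hε
  intro k hk J c Fd G hD hI1 hI2 κ hκ
  have hk0 : 0 < k := hk
  have hκ2 : 0 < κ / 2 := by positivity
  filter_upwards [hAε k hk J c Fd G hD, hBε k hk J c Fd G hD hI1 hI2 (κ / 2) hκ2,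
    eventually_rpow_le_mul_main hk0 hε.1 hε.2 hI1 hI2 hκ2, eventually_floor_wFun_le_floor_y hε.2,
    eventually_wTrick hε.2, eventually_iteratedLogs, eventually_ge_atTop 1]
    with x hAx hBx hEx hwy hw hlogs hx1 m hm hmev hmU q hq hqx hqx'
  obtain ⟨-, hly, -⟩ := hw
  obtain ⟨hL4, hL₂2, -⟩ := hlogs
  have hL0 : 0 < Real.log x := by linarith
  have hm0 : (0 : ℝ) < m := by exact_mod_cast hm
  have hx0 : (0 : ℝ) < x := by exact_mod_cast hx1
  specialize hAx m hm hmev hmU q hq hqx hqx'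
  specialize hBx m hm hmev hmU q hq hqx hqx'
  specialize hEx m hm hmev hmU q
  -- abbreviations
  set N := U C_U ε x * singSeriesMQ k ε x m q * I1 c Fd * I2 k G /
    (m * (Real.log x) ^ k * (Real.log (y ε x)) ^ k) with hN
  set T := singSmall k x * singLarge k ε x m q * I1 c Fd * I2 k G with hT
  set MS := mainSum c Fd G ε x m q with hMS
  set R := U C_U ε x / m * (classCount x m / Pw x) with hR
  have hLk : 0 < (Real.log x) ^ k * (Real.log (y ε x)) ^ k := by positivity
  -- `U ≥ 0` (indeed `U ≥ m x > 0`)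
  have hzL : z x * (Real.log (Real.log x)) ^ 2 = (x : ℝ) * Real.log (Real.log x) := by
    unfold z; field_simp
  have hzpos : 0 < z x * (Real.log (Real.log x)) ^ 2 := by rw [hzL]; positivity
  have hU0 : 0 ≤ U C_U ε x := by
    have h1 := (lt_div_iff₀ hzpos).1 hmU
    have h2 := mul_pos hm0 hzpos
    linarith
  have hR0 : 0 ≤ R := by
    rw [hR]
    exact mul_nonneg (div_nonneg hU0 hm0.le)
      (div_nonneg (classCount_nonneg x m) (Nat.cast_nonneg _))
  -- the identity `N = R · T/((log x)^k (log y)^k)`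
  have hNRT : N = R * (T / ((Real.log x) ^ k * (Real.log (y ε x)) ^ k)) := by
    rw [hN, hR, hT, singSeriesMQ_eq_classCount_mul hk0 ε x m q hwy]
    field_simp
  -- hence `R · MS − N = (R/(log^k x log^k y)) · (MS log^k x log^k y − T)`
  have hdiff : R * MS - N =
      R / ((Real.log x) ^ k * (Real.log (y ε x)) ^ k) *
        (MS * (Real.log x) ^ k * (Real.log (y ε x)) ^ k - T) := by
    rw [hNRT]
    field_simp
  have h2 : |R * MS - N| ≤ κ / 2 * N := by
    rw [hdiff, abs_mul, abs_of_nonneg (div_nonneg hR0 hLk.le)]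
    calc R / ((Real.log x) ^ k * (Real.log (y ε x)) ^ k) *
          |MS * (Real.log x) ^ k * (Real.log (y ε x)) ^ k - T|
        ≤ R / ((Real.log x) ^ k * (Real.log (y ε x)) ^ k) * (κ / 2 * T) :=
          mul_le_mul_of_nonneg_left hBx (div_nonneg hR0 hLk.le)
      _ = κ / 2 * N := by rw [hNRT]; ring
  calc |normInv c Fd G C_U ε x m q - N|
      = |(normInv c Fd G C_U ε x m q - R * MS) + (R * MS - N)| := by ring_nf
    _ ≤ |normInv c Fd G C_U ε x m q - R * MS| + |R * MS - N| := abs_add_le _ _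
    _ ≤ (x : ℝ) ^ (3 / 4 : ℝ) + κ / 2 * N := add_le_add hAx h2
    _ ≤ κ / 2 * N + κ / 2 * N := by linarith [hEx]
    _ = κ * N := by ring

end Maynard2016

end Literature.NumberTheory.Sieve
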